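import Literature.NumberTheory.PAdicHodge.KummerFilZeroCoboundaryRamifiedCurveFO
import Literature.NumberTheory.PAdicHodge.KummerCocycleMatching
import HarnessLib

/-!
# The canonical matching of a good `𝒪_F`-model carries the ALGEBRAIC Kummer cocycle to the formal-group cocycle `κ_u` (ramified base)

Topic `Literature/NumberTheory/PAdicHodge`; namespace `Literature.NumberTheory.PAdicHodge.AinfTop`. THEOREMS ONLY (no definition, no
named fact, no instance, no `sorry`). The `𝒪_D`-currency twin of `KummerCocycleMatching` (case `W/ℤ`): `W` over `CoeffDisc D = 𝒪_D`,
`ψ : 𝒪_D → 𝒪_F` compatible with `𝒪_D → F`, `W♭ = W ⊗_ψ 𝒪_F` with good supersingular reduction at the odd residue characteristic `p`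
(`Δ ∈ 𝒪_F^×`, `A_p(W♭ mod 𝔪_F) = 0`), `E = curveFO F W♭`, `e = tateGeomEquivTatePtOSS F W♭ p` (`AinfWeierstrassTateModuleGeomO`),
`κ_u = AinfRamTop.kummerCocycleO` (`AinfRamifiedDivisionLift`):

* §1 `mem_kernel_of_pow_smul_mem_kernel_O`, `geomToCO_divSeq_mem_kernel` — at good supersingular reduction
  the `p`-power division points of a point of `E₁(ℂ_F)` lie in `E₁(ℂ_F)` (`reducesToZero_of_pow_prime_smul_reducesToZero`);
* §2 `pow_smul_kummerO_eq_zero`, `smul_kummerO_succ` — the algebraic Kummer element `(σQₙ − Qₙ)ₙ ∈ T_pE(F̄)`;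
* §3 `proj_tateGeomEquivTatePtOSS` — the components of `e` through AEC VII.2.2 `kernelEquivPt`;
* §4 `mulPC_zPt_divSeqO`, ★ **`tateGeomEquivTatePtOSS_kummer`**: `e((σQₙ − Qₙ)ₙ) = κ_u(σ)`, `uₙ = z(Qₙ)`;
* §5 ★★ **`isFilZeroCoboundary_kummerO_curveFO`**: for a `Γ_F`-fixed `Q₀ ∈ E₁` whose parameter `u₀ = z(Q₀)` has a `Γ_F`-fixed lift
  `Q̂ ∈ Ŵ(𝔫_𝒪)` (e.g. `𝒪_D`-rational points: `AinfRamTop.coeffPt`), (N1′) `∫ω ≢ 0` and (Nη) `∫η ⊄ Fil¹`: the algebraic Kummer cocycle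
  `σ ↦ 1 ⊗ (σQₙ − Qₙ)ₙ` is a `Fil⁰`-coboundary of `B_dR(F) ⊗ V_pE` (`isFilZeroCoboundary_kummerCocycleO_curveFO` + §4) — K1 on the good
  `𝒪_D`-models (the currency of the K★ cells) with the cocycle written in the Kummer theory of `E`.

Crux K★ `stmt-BirchSwinnertonDyer-22226`, hT₂ programme brick K1. BSD / K★ are not proved by any of this.

## References
* [SilvermanAEC2009] J. H. Silverman, *AEC* (2009), Prop. VII.2.1–VII.2.2, VIII.§2, III.§7.
* [BlochKato1990] S. Bloch, K. Kato (1990), Ex. 3.10.1, Example 3.11.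
* [Serre1972] J.-P. Serre, Invent. Math. 15 (1972), §1.11.
-/

noncomputable section

open scoped TensorProduct Classical

namespace Literature.NumberTheory.PAdicHodge

open Literature Literature.NumberTheory.GaloisRepresentations Literature.NumberTheory.EllipticCurves WeierstrassCurve
open Literature.NumberTheory.GaloisRepresentations.IsNonarchimedeanLocalField Field ValuativeRel
open Literature.NumberTheory.GaloisRepresentations.LubinTate Literature.NumberTheory.EllipticCurves.FormalGroupChart

namespace AinfTop

section KernelO

variable {F : Type} [Field F] [ValuativeRel F] [TopologicalSpace F] [IsNonarchimedeanLocalField F]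
  (W : WeierstrassCurve (LTCoeff F)) {p : ℕ}

/-! ## §1 Division points of formal points are formal (`𝒪_F`-model) -/

variable [Fact p.Prime] [CharP 𝓀[F] p]

/-- **At good supersingular reduction of the `𝒪_F`-model, `pⁿ`-division points of points of `E₁(ℂ_F)` lie in `E₁(ℂ_F)`** (`Δ ∈ 𝒪_F^×`,
`A_p(W mod 𝔪_F) = 0`, `p` odd). [cite: SilvermanAEC2009, Prop. VII.2.1 and Thm. V.3.1(a)] [cite: Serre1972, §1.11] -/
theorem mem_kernel_of_pow_smul_mem_kernel_O (hp2 : p ≠ 2) (hΔ : IsUnit W.Δ) (hA : (W.map (redCoeff F)).hasseCoeff p = 0) (n : ℕ)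
    {Q : (curveOver (CompletedAlgClosure F) W).toAffine.Point}
    (hQ : p ^ n • Q ∈ kernel (NormedField.valuation (K := CompletedAlgClosure F)) (curveOver (CompletedAlgClosure F) W)) :
    Q ∈ kernel (NormedField.valuation (K := CompletedAlgClosure F)) (curveOver (CompletedAlgClosure F) W) := by
  -- the two descriptions of `E₁(ℂ_F)` (`‖x‖ > 1` / `x ∉ 𝒪_{ℂ_F}`), as in `mem_kernel_iff_reducesToZero` for `ℤ`-models
  have key : ∀ P : (curveOver (CompletedAlgClosure F) W).toAffine.Point,
      P ∈ kernel (NormedField.valuation (K := CompletedAlgClosure F)) (curveOver (CompletedAlgClosure F) W) ↔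
        WeierstrassCurve.ReducesToZero (ballIntModel (CompletedAlgClosure F) W) P := fun P => by
    rcases P with _ | ⟨x, y, h⟩
    · exact ⟨fun _ => WeierstrassCurve.reducesToZero_zero (W := ballIntModel (CompletedAlgClosure F) W),
        fun _ => (kernel (NormedField.valuation (K := CompletedAlgClosure F)) (curveOver (CompletedAlgClosure F) W)).zero_mem⟩
    · exact (some_mem_kernel_iff h).trans
        ((not_mem_range_iff (Valuation.integer.integers (NormedField.valuation (K := CompletedAlgClosure F)))).symm.trans
          (WeierstrassCurve.reducesToZero_some_iff (W := ballIntModel (CompletedAlgClosure F) W) h).symm)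
  rw [key] at hQ ⊢
  refine reducesToZero_of_pow_prime_smul_reducesToZero (Valuation.integer.integers _) (isUnit_Δ_ballIntModel_O W hΔ)
    (reduction_no_pTorsion_O W hp2 hΔ hA) (n := n) ?_
  have hQ' : WeierstrassCurve.ReducesToZero (ballIntModel (CompletedAlgClosure F) W) (((p ^ n : ℕ) : ℤ) • Q) := by
    rwa [natCast_zsmul]
  rw [Nat.cast_pow] at hQ'
  exact hQ'

variable [CharZero F] [(curveFO F W).IsElliptic]

omit [CharZero F] [(curveFO F W).IsElliptic] in
/-- **Every point of a `p`-power division sequence of a point of `E₁` lies in `E₁(ℂ_F)`** (`𝒪_F`-model, good supersingular reduction).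
[cite: SilvermanAEC2009, Prop. VII.2.1] [cite: Serre1972, §1.11] -/
theorem geomToCO_divSeq_mem_kernel (hp2 : p ≠ 2) (hΔ : IsUnit W.Δ) (hA : (W.map (redCoeff F)).hasseCoeff p = 0)
    {Q : ℕ → (curveFO F W).geomPoints} (hQ : ∀ n, p • Q (n + 1) = Q n)
    (hQ0 : geomToCO W (Q 0) ∈ kernel (NormedField.valuation (K := CompletedAlgClosure F)) (curveOver (CompletedAlgClosure F) W))
    (n : ℕ) : geomToCO W (Q n) ∈ kernel (NormedField.valuation (K := CompletedAlgClosure F)) (curveOver (CompletedAlgClosure F) W) := by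
  refine mem_kernel_of_pow_smul_mem_kernel_O W hp2 hΔ hA n ?_
  rw [← map_nsmul, pow_smul_divSeq hQ]
  exact hQ0

end KernelO

section MatchingO

variable {F : Type} [Field F] [ValuativeRel F] [TopologicalSpace F] [IsNonarchimedeanLocalField F] [CharZero F]
  {p : ℕ} [Fact p.Prime] [CharP 𝓀[F] p] {hp : valuation F p < 1} {D : EisensteinRoot F p hp}
  (W : WeierstrassCurve (EisensteinRoot.CoeffDisc D)) (ψ : EisensteinRoot.CoeffDisc D →+* LTCoeff F)
  [(curveFO F (W.map ψ)).IsElliptic] [hE : (curveOver (CompletedAlgClosure F) (W.map ψ)).IsElliptic]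

/-! ## §2 The algebraic Kummer element of a division sequence -/

omit [CharP 𝓀[F] p] [(curveFO F (W.map ψ)).IsElliptic] hE in
/-- `pⁿ • (σQₙ − Qₙ) = 0` for a division sequence with `Γ_F`-fixed base. [cite: SilvermanAEC2009, VIII.§2] -/
theorem pow_smul_kummerO_eq_zero {Q : ℕ → (curveFO F (W.map ψ)).geomPoints} (hQ : ∀ n, p • Q (n + 1) = Q n)
    (hfix : ∀ σ : absoluteGaloisGroup F, σ • Q 0 = Q 0) (σ : absoluteGaloisGroup F) (n : ℕ) : p ^ n • (σ • Q n - Q n) = 0 := by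
  have h : p ^ n • (σ • Q n) = σ • (p ^ n • Q n) := (map_nsmul (DistribSMul.toAddMonoidHom _ σ) (p ^ n) (Q n)).symm
  rw [smul_sub, h, pow_smul_divSeq hQ, hfix, sub_self]

omit [CharP 𝓀[F] p] [(curveFO F (W.map ψ)).IsElliptic] hE in
/-- `p • (σQ_{n+1} − Q_{n+1}) = σQₙ − Qₙ`. [cite: SilvermanAEC2009, VIII.§2] -/
theorem smul_kummerO_succ {Q : ℕ → (curveFO F (W.map ψ)).geomPoints} (hQ : ∀ n, p • Q (n + 1) = Q n) (σ : absoluteGaloisGroup F)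
    (n : ℕ) : p • (σ • Q (n + 1) - Q (n + 1)) = σ • Q n - Q n := by
  have h : p • (σ • Q (n + 1)) = σ • (p • Q (n + 1)) := (map_nsmul (DistribSMul.toAddMonoidHom _ σ) p (Q (n + 1))).symm
  rw [smul_sub, h, hQ]

/-! ## §3 Components of the matching -/

omit [(curveFO F (W.map ψ)).IsElliptic] in
/-- **The `n`-th component of `e(τ)` is the formal point of `τₙ`** (`𝒪_F`-model). [cite: SilvermanAEC2009, Prop. VII.2.2] -/
theorem proj_tateGeomEquivTatePtOSS (hp2 : p ≠ 2) (hΔ : IsUnit (W.map ψ).Δ) (hA : ((W.map ψ).map (redCoeff F)).hasseCoeff p = 0)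
    (τ : (curveFO F (W.map ψ)).tateModule p) (n : ℕ)
    (h : geomToCO (W.map ψ) (TateModule.proj p n τ) ∈
      kernel (NormedField.valuation (K := CompletedAlgClosure F)) (curveOver (CompletedAlgClosure F) (W.map ψ))) :
    TateModule.proj p n (tateGeomEquivTatePtOSS F (W.map ψ) p hp2 hΔ hA τ) =
      kernelEquivPt (CompletedAlgClosure F) (W.map ψ) ⟨geomToCO (W.map ψ) (TateModule.proj p n τ), h⟩ := by
  refine WeierstrassCurve.Pt.ext (Subtype.ext (Subtype.ext ?_))
  have h1 : ((((TateModule.proj p n (tateGeomEquivTatePtOSS F (W.map ψ) p hp2 hΔ hA τ)).val : (maxNilIdealC F).toIdeal) : CBall F) :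
      CompletedAlgClosure F) = (TateModule.proj p n (tateGeomEquivCO F (W.map ψ) p hΔ τ)).zCoord := rfl
  rw [h1, proj_tateGeomEquivCO, kernelEquivPt_apply_val, coe_zPt]

/-! ## §4 `e(algebraic Kummer element) = κ_u` -/

omit [CharP 𝓀[F] p] [(curveFO F (W.map ψ)).IsElliptic] in
/-- The formal coordinates `uₙ := z(Qₙ)` form a `[p]_W`-division sequence (`z(p • Q) = [p]_W z(Q)`, AEC VII.2.2, read through `ψ`).
[cite: SilvermanAEC2009, Prop. VII.2.2] -/
theorem mulPC_zPt_divSeqO (hψ : ∀ c, algebraMap (LTCoeff F) F (ψ c) = EisensteinRoot.CoeffDisc.toF D c)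
    {Q : ℕ → (curveFO F (W.map ψ)).geomPoints} (hQ : ∀ n, p • Q (n + 1) = Q n)
    (hker : ∀ n, geomToCO (W.map ψ) (Q n) ∈
      kernel (NormedField.valuation (K := CompletedAlgClosure F)) (curveOver (CompletedAlgClosure F) (W.map ψ))) (n : ℕ) :
    AinfRamTop.mulPC W (zPt (geomToCO (W.map ψ) (Q (n + 1))) (hker (n + 1))) = zPt (geomToCO (W.map ψ) (Q n)) (hker n) := by
  have h := congrArg WeierstrassCurve.Pt.val
    (map_nsmul (kernelEquivPt (CompletedAlgClosure F) (W.map ψ)) p ⟨geomToCO (W.map ψ) (Q (n + 1)), hker (n + 1)⟩)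
  have h2 : p • (⟨geomToCO (W.map ψ) (Q (n + 1)), hker (n + 1)⟩ :
      kernel (NormedField.valuation (K := CompletedAlgClosure F)) (curveOver (CompletedAlgClosure F) (W.map ψ))) =
      ⟨geomToCO (W.map ψ) (Q n), hker n⟩ := Subtype.ext (by
    change p • geomToCO (W.map ψ) (Q (n + 1)) = geomToCO (W.map ψ) (Q n)
    rw [← map_nsmul, hQ])
  rw [h2] at h
  calc AinfRamTop.mulPC W (zPt (geomToCO (W.map ψ) (Q (n + 1))) (hker (n + 1)))
      = (p • (kernelEquivPt (CompletedAlgClosure F) (W.map ψ) ⟨geomToCO (W.map ψ) (Q (n + 1)), hker (n + 1)⟩ :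
          (W.map ψ).Pt (maxNilIdealC F))).val :=
        (AinfRamTop.val_p_nsmul_map_ψ W ψ hψ _).symm
    _ = (kernelEquivPt (CompletedAlgClosure F) (W.map ψ) ⟨geomToCO (W.map ψ) (Q n), hker n⟩).val := h.symm
    _ = zPt (geomToCO (W.map ψ) (Q n)) (hker n) := kernelEquivPt_apply_val _

omit [CharP 𝓀[F] p] [(curveFO F (W.map ψ)).IsElliptic] hE in
/-- The base `u₀ = z(Q₀)` is fixed by `Γ_F` when `Q₀` is. [cite: SilvermanAEC2009, VIII.§2] -/
theorem galCBall_zPt_divSeqO_zero {Q : ℕ → (curveFO F (W.map ψ)).geomPoints} (hfix : ∀ σ : absoluteGaloisGroup F, σ • Q 0 = Q 0)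
    (hker : ∀ n, geomToCO (W.map ψ) (Q n) ∈
      kernel (NormedField.valuation (K := CompletedAlgClosure F)) (curveOver (CompletedAlgClosure F) (W.map ψ)))
    (σ : absoluteGaloisGroup F) :
    galCBall σ (zPt (geomToCO (W.map ψ) (Q 0)) (hker 0) : CBall F) = zPt (geomToCO (W.map ψ) (Q 0)) (hker 0) := by
  have h := zCoord_galPointHom (W := W.map ψ) (CompletedAlgClosure.galRingHom σ) (galRingHom_cK_ltCoeff σ) (geomToCO (W.map ψ) (Q 0))
  change (galPointCO (W.map ψ) σ (geomToCO (W.map ψ) (Q 0))).zCoord = _ at h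
  rw [← geomToCO_smul, hfix] at h
  apply Subtype.ext
  change ((galCBallAlgHom σ (zPt (geomToCO (W.map ψ) (Q 0)) (hker 0) : CBall F) : CBall F) : CompletedAlgClosure F) = _
  rw [← galRingHom_coe, coe_zPt]
  exact h.symm

omit [(curveFO F (W.map ψ)).IsElliptic] in
/-- ★ **The canonical matching carries the algebraic Kummer element to `κ_u`** (`𝒪_D`-currency): for a `p`-power division sequence `Q`
in `E(F̄)` of a `Γ_F`-fixed point `Q₀ ∈ E₁` (good supersingular `𝒪_F`-model), with `uₙ = z(Qₙ)`: `e((σQₙ − Qₙ)ₙ) = κ_u(σ)`.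
[cite: SilvermanAEC2009, Prop. VII.2.2 and VIII.§2] [cite: BlochKato1990, Ex. 3.10.1] -/
theorem tateGeomEquivTatePtOSS_kummer (hψ : ∀ c, algebraMap (LTCoeff F) F (ψ c) = EisensteinRoot.CoeffDisc.toF D c)
    (hp2 : p ≠ 2) (hΔ : IsUnit (W.map ψ).Δ) (hA : ((W.map ψ).map (redCoeff F)).hasseCoeff p = 0)
    {Q : ℕ → (curveFO F (W.map ψ)).geomPoints} (hQ : ∀ n, p • Q (n + 1) = Q n) (hfix : ∀ σ : absoluteGaloisGroup F, σ • Q 0 = Q 0)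
    (hker : ∀ n, geomToCO (W.map ψ) (Q n) ∈
      kernel (NormedField.valuation (K := CompletedAlgClosure F)) (curveOver (CompletedAlgClosure F) (W.map ψ)))
    {hup : ∀ n, AinfRamTop.mulPC W (zPt (geomToCO (W.map ψ) (Q (n + 1))) (hker (n + 1))) = zPt (geomToCO (W.map ψ) (Q n)) (hker n)}
    {hu₀ : ∀ σ : absoluteGaloisGroup F,
      galCBall σ (zPt (geomToCO (W.map ψ) (Q 0)) (hker 0) : CBall F) = zPt (geomToCO (W.map ψ) (Q 0)) (hker 0)}
    (σ : absoluteGaloisGroup F) :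
    tateGeomEquivTatePtOSS F (W.map ψ) p hp2 hΔ hA
        (TateModule.mk (fun n => σ • Q n - Q n) (pow_smul_kummerO_eq_zero W ψ hQ hfix σ) (smul_kummerO_succ W ψ hQ σ)) =
      AinfRamTop.kummerCocycleO W ψ hψ (fun n => zPt (geomToCO (W.map ψ) (Q n)) (hker n)) hup hu₀ σ := by
  refine TateModule.ext fun n => ?_
  have hB : geomToCO (W.map ψ) (Q n) ∈
      kernel (NormedField.valuation (K := CompletedAlgClosure F)) (curveOver (CompletedAlgClosure F) (W.map ψ)) := hker n
  have hAk : galPointCO (W.map ψ) σ (geomToCO (W.map ψ) (Q n)) ∈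
      kernel (NormedField.valuation (K := CompletedAlgClosure F)) (curveOver (CompletedAlgClosure F) (W.map ψ)) :=
    galPointHom_mem_kernel (CompletedAlgClosure.galRingHom σ) (galRingHom_cK_ltCoeff σ) (norm_galRingHom σ) (@hB)
  have hAB : geomToCO (W.map ψ) (TateModule.proj p n
      (TateModule.mk (fun n => σ • Q n - Q n) (pow_smul_kummerO_eq_zero W ψ hQ hfix σ) (smul_kummerO_succ W ψ hQ σ))) ∈
      kernel (NormedField.valuation (K := CompletedAlgClosure F)) (curveOver (CompletedAlgClosure F) (W.map ψ)) := by
    rw [TateModule.proj_mk, map_sub, geomToCO_smul]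
    exact (kernel (NormedField.valuation (K := CompletedAlgClosure F)) (curveOver (CompletedAlgClosure F) (W.map ψ))).sub_mem
      (@hAk) (@hB)
  rw [proj_tateGeomEquivTatePtOSS W ψ hp2 hΔ hA _ n (@hAB), AinfRamTop.proj_kummerCocycleO]
  have hsub : (⟨geomToCO (W.map ψ) (TateModule.proj p n
      (TateModule.mk (fun n => σ • Q n - Q n) (pow_smul_kummerO_eq_zero W ψ hQ hfix σ) (smul_kummerO_succ W ψ hQ σ))), hAB⟩ :
      kernel (NormedField.valuation (K := CompletedAlgClosure F)) (curveOver (CompletedAlgClosure F) (W.map ψ))) =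
      ⟨galPointCO (W.map ψ) σ (geomToCO (W.map ψ) (Q n)), hAk⟩ - ⟨geomToCO (W.map ψ) (Q n), hB⟩ := Subtype.ext (by
    change geomToCO (W.map ψ) (TateModule.proj p n _) = galPointCO (W.map ψ) σ (geomToCO (W.map ψ) (Q n)) - geomToCO (W.map ψ) (Q n)
    rw [TateModule.proj_mk, map_sub, geomToCO_smul])
  rw [hsub, map_sub]
  have hBpt : (⟨zPt (geomToCO (W.map ψ) (Q n)) (hker n)⟩ : (W.map ψ).Pt (maxNilIdealC F)) =
      kernelEquivPt (CompletedAlgClosure F) (W.map ψ) ⟨geomToCO (W.map ψ) (Q n), hB⟩ :=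
    WeierstrassCurve.Pt.ext (by rw [kernelEquivPt_apply_val])
  have hApt : galPtO (W.map ψ) σ (kernelEquivPt (CompletedAlgClosure F) (W.map ψ) ⟨geomToCO (W.map ψ) (Q n), hB⟩) =
      kernelEquivPt (CompletedAlgClosure F) (W.map ψ) ⟨galPointCO (W.map ψ) σ (geomToCO (W.map ψ) (Q n)), hAk⟩ :=
    (kernelEquivPt_galPointHom (CompletedAlgClosure.galRingHom σ) (galRingHom_cK_ltCoeff σ) (norm_galRingHom σ)
      (galCBallCoeffAlgHom σ) (continuous_galCBall σ) (fun _ hx => galCBall_mem hx) (fun _ => rfl)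
      ⟨geomToCO (W.map ψ) (Q n), hB⟩).symm
  rw [hBpt]
  change _ = galPtO (W.map ψ) σ _ - _
  rw [hApt]
  rfl

/-! ## §5 K1 in the currency of the Kummer theory of `E` (ramified base) -/

/-- ★★ **K1 for algebraic Kummer cocycles over the ramified base.** `W` over `𝒪_D`, `W♭ = W ⊗_ψ 𝒪_F` a good model with supersingular
reduction at the odd residue characteristic `p`, (N1′) `∫_τ ω ≠ 0` and (Nη) `∫_τ η ∉ Fil¹` for some Tate-module points; `Q` a `p`-power
division sequence in `E(F̄)` of a `Γ_F`-fixed point `Q₀ ∈ E₁` whose parameter `u₀` (`= z(Q₀)`) has a `Γ_F`-fixed lift `Q̂ ∈ Ŵ(𝔫_𝒪)`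
(e.g. `AinfRamTop.coeffPt c` for an `𝒪_D`-rational point). Then `σ ↦ 1 ⊗ (σQₙ − Qₙ)ₙ` is a `Fil⁰`-coboundary of `B_dR(F) ⊗ V_pE`.
[cite: BlochKato1990, Ex. 3.10.1, Example 3.11] [cite: SilvermanAEC2009, Prop. VII.2.2] -/
theorem isFilZeroCoboundary_kummerO_curveFO
    [Fact (¬ IsUnit (p : integerC F))] [IsAdicComplete (Ideal.span {(p : integerC F)}) (integerC F)] [Algebra ℚ_[p] F]
    (hψ : ∀ c, algebraMap (LTCoeff F) F (ψ c) = EisensteinRoot.CoeffDisc.toF D c) (hp2 : p ≠ 2) (hΔ : IsUnit (W.map ψ).Δ) (hA : ((W.map ψ).map (redCoeff F)).hasseCoeff p = 0)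
    (hN1 : ∃ τ : TatePtO F (W.map ψ) p, AinfRamTop.omegaPeriodHomO W ψ (surjective_fontaineTheta_integerC hp) hψ τ ≠ 0)
    (hNη : ∃ τ : TatePtO F (W.map ψ) p,
      AinfRamTop.etaPeriodHomO W ψ (surjective_fontaineTheta_integerC hp) hψ τ ∉ (BdRPlusTop.filOne F p).toIdeal)
    {Q : ℕ → (curveFO F (W.map ψ)).geomPoints} (hQ : ∀ n, p • Q (n + 1) = Q n) (hfix : ∀ σ : absoluteGaloisGroup F, σ • Q 0 = Q 0)
    (hQ0 : geomToCO (W.map ψ) (Q 0) ∈ kernel (NormedField.valuation (K := CompletedAlgClosure F)) (curveOver (CompletedAlgClosure F) (W.map ψ)))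
    {u₀ : (maxNilIdealC F).toIdeal} (hu₀Q : ((u₀ : CBall F) : CompletedAlgClosure F) = (geomToCO (W.map ψ) (Q 0)).zCoord)
    {Qhat : W.Pt (AinfRamTop.nilTheta D (surjective_fontaineTheta_integerC hp))}
    (hQhat : AinfRamTop.thetaPt W (surjective_fontaineTheta_integerC hp) Qhat = ⟨u₀⟩)
    (hQhatσ : ∀ σ : absoluteGaloisGroup F, AinfRamTop.galPtN W (surjective_fontaineTheta_integerC hp) σ Qhat = Qhat) :
    (bdRPeriodRingData (F := F) (p := p) hp).IsFilZeroCoboundary (rationalTateRep (curveFO F (W.map ψ)) p) fun σ =>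
      ((1 : (bdRPeriodRingData (F := F) (p := p) hp).B) ⊗ₜ[ℚ_[p]]
        TateModule.toRational p (TateModule.mk (fun n => σ • Q n - Q n) (pow_smul_kummerO_eq_zero W ψ hQ hfix σ)
          (smul_kummerO_succ W ψ hQ σ)) :
        (bdRPeriodRingData (F := F) (p := p) hp).B ⊗[ℚ_[p]] (curveFO F (W.map ψ)).rationalTateModule p) := by
  have hker := geomToCO_divSeq_mem_kernel (W.map ψ) hp2 hΔ hA hQ hQ0
  have hup := mulPC_zPt_divSeqO W ψ hψ hQ hker
  have e0 : zPt (geomToCO (W.map ψ) (Q 0)) (hker 0) = u₀ := Subtype.ext (Subtype.ext (by rw [coe_zPt, hu₀Q]))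
  have hQhat' : AinfRamTop.thetaPt W (surjective_fontaineTheta_integerC hp) Qhat = ⟨zPt (geomToCO (W.map ψ) (Q 0)) (hker 0)⟩ := by
    rw [e0]; exact hQhat
  have h := isFilZeroCoboundary_kummerCocycleO_curveFO hp D W ψ hψ hp2 hΔ hA hN1 hNη
    (u := fun n => zPt (geomToCO (W.map ψ) (Q n)) (hker n)) hup (Q := Qhat) hQhat' hQhatσ
  have hmain : ∀ σ : absoluteGaloisGroup F,
      (tateGeomEquivTatePtOSS F (W.map ψ) p hp2 hΔ hA).symm
          (AinfRamTop.kummerCocycleO W ψ hψ (fun n => zPt (geomToCO (W.map ψ) (Q n)) (hker n)) hup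
            (AinfRamTop.galCBall_base_eq_of_fixedLift W (u := fun n => zPt (geomToCO (W.map ψ) (Q n)) (hker n)) hQhat' hQhatσ) σ) =
        TateModule.mk (fun n => σ • Q n - Q n) (pow_smul_kummerO_eq_zero W ψ hQ hfix σ) (smul_kummerO_succ W ψ hQ σ) :=
    fun σ => by
    rw [LinearEquiv.symm_apply_eq]
    exact (tateGeomEquivTatePtOSS_kummer W ψ hψ hp2 hΔ hA hQ hfix hker (hup := hup)
      (hu₀ := AinfRamTop.galCBall_base_eq_of_fixedLift W (u := fun n => zPt (geomToCO (W.map ψ) (Q n)) (hker n)) hQhat' hQhatσ)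
      σ).symm
  refine h.congr fun σ => ?_
  rw [hmain σ]

end MatchingO

end AinfTop

end Literature.NumberTheory.PAdicHodge

end
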